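import Summits.QuantumFields.YangMills.Theorems.BalabanUVNodesN09FibreIntegralContinuousOfChartRegularity
import Summits.QuantumFields.YangMills.Theorems.BalabanUVNodesN09HregOfFibredChartAtRecord

/-!
# NODE N09 · THE (F1) TOWER RUN: by induction on the step, A-FREE per-step chart regularity ⇒ `A_j` continuous on every `domAlt_j`, `hreg_j` and (F3)_j for all `j < K`;
# dag-n09-w4 g3's small-field-bookkeeping door with the analytic inclusion `hreg` REPLACED by per-step chart regularity (no `A` in the chart data)

Cell `pub-ymgap` (YM-PLAN Track A), DAG node N09 [Balaban1987RG1] (= [I]); seat `pub-ymgap-dag-n09-w1` g5 (D-0149 width seat 1 of node N09), FILE 3; count-neutral helper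
keyed to K1⁷ `StabilityBAtRecordR13SepCoPH` = stmt-QuantumFields-20542 (`--kind proof --supports … --as helper`).  HONEST FRAMING: kernel induction BY NAME over FILE 2's step and
base; NOTHING of Bałaban's analysis asserted; every chart datum DISPLAYED ((M3r) stays UNOWNED); N09 NOT discharged; K0⁷∕K1⁷ NOT closed; counts unmoved (typed 28∕28 ·
discharged 5∕27); one finite 𝕋⁴ programme at fixed ε — R4 closes the conditional rung `BalabanLadder.UV` only; the Yang–Mills mass gap (Clay) is NOT proved by any of this;
nothing continuum ∕ ℝ⁴ ∕ OS.

WHY.  FILE 2 (`…N09FibreIntegralContinuousOfChartRegularity`) proved THE STEP `ContinuousOn A_k domAlt_k → [step-k chart regularity] → ContinuousOn A_{k+1} domAlt_{k+1}` (with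
`hreg_k` and (F3)_k as by-products) and THE BASE `A_0` continuous.  THIS FILE runs the induction along a torus `K` and history `g` (§1), and at the Stage-13 record per run `P`
(§2): the displayed analytic-inclusion binder `hreg : ∀ j < P.K, domAlt_{j+1} ⊆ regSetOfRecord P.K j ρ_j` of the N09 doors (dag-n09-w3 g2 ∕ dag-n09-w4 g3) becomes a THEOREM
of per-step chart data in which the effective actions `A_j` NO LONGER APPEAR — dag-n09-w6 g2's re-shaping (`hreg` ↦ chart + `hgc`) with the recursion hidden in `hgc` now
resolved by induction.  What the producer of the charts owes per step `j < K` is GEOMETRY + STANDARD ANALYSIS of [I]'s (2.10) substitution: the sockets `hΦ hJ havgΦ hmap` over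
`domAlt_{j+1}` on `{χ^{(2.9)}_j ≠ 0}`, the base point `B₁ = 0` (`hz₀ hΦc hJpos`), a.e. continuity of `Φ`, `J` and of the (2.9) deviations in the coarse field (`hΦV hJV hφ` —
the last is N07 ∕ selector content), fibre-nullity of the exact thresholds (`hnull`), local domination with COMPACT CONFINEMENT in `domAlt_j` (`hconf`), `GF_j` continuous on
`domAlt_j` (`hGF`), a.e.-strong measurability of the fibre integrand (`hmeas`); plus [B11] solvability `hsolν`, (I19) `hint`, `0 < ε₂₉`.

WHAT IS PROVED (theorems only; 0 def; 0 sorry; axioms standard).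
* §1 ALONG A TORUS `K` AND A HISTORY `g` (`ν`, `0 < ε₁`, `T = TcanOfRecord`): ★★★ `continuousOn_effActionHT_all_of_chartRegularity` (`∀ j ≤ K, ContinuousOn A_j domAlt_j`, induction on
  `j` from FILE 2's base and step), ★★★ `hreg_pos_all_of_chartRegularity` (`∀ j < K`: `hreg_j` ∧ `∀ V ∈ domAlt_{j+1}, 0 < TcanOfRecord K j ρ_j V`).
* §2 AT THE STAGE-13 RECORD (run `P`; `TβOfRecord₁₃ = TcanOfRecord`, `chiβOfRecord₁₃ θ = chiFixed29 θ.ν θ.ε₂₉`, charted sets pinned to `{χ^{(2.9)}_j ≠ 0}` as in dag-n09-w6 g2's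
  `…OnChiSupport…` door): ★★ `hreg_of_chartRegularity` (the doors' binder `hreg` VERBATIM), ★★ `pos_of_chartRegularity` ((F3) on every domain), ★★ `normConst_pos_and_eq_exp_of_chartRegularity` (`𝐍_j > 0` and (0.19) `T_jρ_j = 𝐍_j·e^{A_{j+1}}` ON EVERY DOMAIN, `0 < ν.ε₀`),
  ★★★ `thm3Member_stage13SepCoPH_atDomAlt_of_chartRegularity_of_numerics_of_εreg_eq` (dag-n09-w4 g3's door `…_atDomAlt_of_numerics_of_εreg_eq` with `hreg` GONE: N09-side inputs
  = (181)ˢᵒˡ `hcov`, `hsolν` + [B11] ×3 (N07), (I19) `hint`, NUMERICS, and A-FREE per-step chart regularity).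

HONEST SCOPE.  As FILE 2: every chart datum displayed; `hφ` (N07 ∕ selector), `hGF` (Federbush-contour continuity on the domain), `hmeas` displayed; `hsolν`, `hint`, `hcov`,
[B11] ×3 and the numerics displayed as in the door; nothing of w4 ∕ w6 ∕ K0e ∕ FILES 1–2 re-proved.
-/

noncomputable section

open MeasureTheory Set Filter Topology
open scoped ENNReal NNReal
open Literature.MathematicalPhysics.QuantumFieldTheory
open Literature.MathematicalPhysics.QuantumFieldTheory.Balaban1983to89
open Literature.MathematicalPhysics.QuantumFieldTheory.Balaban1983to89.Node00
open Literature.MathematicalPhysics.QuantumFieldTheory.Balaban1983to89.T4Continuum (T4Family)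
open Literature.MathematicalPhysics.QuantumFieldTheory.Balaban1983to89.DagBinding (WorldP leavesP)
open Literature.MathematicalPhysics.QuantumFieldTheory.Balaban1983to89.B12RTGaugeInvariance254 (liftTransf)
open Literature.MathematicalPhysics.QuantumFieldTheory.Balaban1983to89.GaugeField (gaugeAct)
open Literature.MathematicalPhysics.QuantumFieldTheory.Balaban1983to89.ExpMeanLog (deltaSU)
open Literature.MathematicalPhysics.QuantumFieldTheory.Balaban1983to89.B12Eq019ActionBody (normConst_mul_exp_nextAction)
open Summit.QuantumFields.YangMills.BalabanUVNodes.N09FibreIntegralContinuousOfChartRegularity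
open Summit.QuantumFields.YangMills.BalabanUVNodes.N09HregOfFibredChartAtRecord (mem_setOf_chi_ne_zero_of_betaInputOfRecord_ne_zero)
open Summit.QuantumFields.YangMills.BalabanUVNodes.N09B0RiderAtRecord (thm3Member_stage13SepCoPH_atDomAlt_of_numerics_of_εreg_eq)

namespace Summit.QuantumFields.YangMills.BalabanUVNodes.N09RegularityTowerOfChartRegularity

variable {F : T4Family} {N : ℕ} [NeZero N]

/-! ## §1 Along a torus `K` and a history `g`: the induction on the step -/

section Tower

variable (ν : Stage7Numerics) {ε₁ : ℝ} (K : ℕ) (g : ℕ → ℝ)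
  {Z : ℕ → Type*} [∀ j, TopologicalSpace (Z j)] [∀ j, MeasurableSpace (Z j)] (τ : ∀ j, Measure (Z j)) [∀ j, SFinite (τ j)] [∀ j, (τ j).IsOpenPosMeasure]
  (Φ : ∀ j, (PBond (F.P K) (j + 1) → SU N) × Z j → GaugeField (F.P K) j (SU N))
  (J : ∀ j, (PBond (F.P K) (j + 1) → SU N) × Z j → ℝ≥0)
  (z₀ : ∀ j, (PBond (F.P K) (j + 1) → SU N) → Z j)

/-- **★★★ THE (F1) TOWER: `A_j` IS CONTINUOUS ON `domAlt_j` FOR EVERY `j ≤ K`**, by induction on `j` — base FILE 2's `continuousOn_effActionHT_zero` (`A_0 = −A∕g_0²`), step FILE 2's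
`continuousOn_effActionHT_succ_of_chartRegularity` read at the per-step data: for each `j < K` a fibred chart `(Z j, τ j, Φ j, J j)` of the averaging of record over
`domAlt_{j+1}` on `{χ^{(2.9)}_j ≠ 0}` through the critical configuration (`hΦ hJ havgΦ hmap hz₀ hΦc hJpos`) with A-FREE regularity (`hmeas hconf hΦV hJV hφ hnull`), `GF_j`
continuous on `domAlt_j`, [B11] solvability on `domAlt_{j+1}`, (I19) integrability of `ρ_j`, `0 < ε₁`.  Nothing of Bałaban's asserted.
[cite: Balaban1987RG1, (0.17)–(0.19) p.255, p.259, (2.9) p.266 and (2.10) p.267] -/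
theorem continuousOn_effActionHT_all_of_chartRegularity (hε : 0 < ε₁)
    (hsolν : ∀ j < K, ∀ W ∈ domAltOfRecord F N ν K (j + 1), UkExists F N K (j + 1) ν.εreg W)
    (hint : ∀ j < K, Integrable (betaInputOfRecord F N (TcanOfRecord F N) (chiFixed29 F N ν ε₁) K g j) (fieldMeasure (F.P K) j (SU N)))
    (hGF : ∀ j < K, ContinuousOn (gfOfRecord F N K j) (domAltOfRecord F N ν K j))
    (hΦ : ∀ j, Measurable (Φ j)) (hJ : ∀ j, Measurable (J j))
    (havgΦ : ∀ j < K, ∀ V ∈ domAltOfRecord F N ν K (j + 1), ∀ z, (avOfRecord F N K j).avg (Φ j (V, z)) = V)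
    (hmap : ∀ j < K, (fieldMeasure (F.P K) j (SU N)).restrict ((avOfRecord F N K j).avg ⁻¹' domAltOfRecord F N ν K (j + 1) ∩
        {U | chiFixed29 F N ν ε₁ K g j U ≠ 0})
      = ((((piHaar (F.P K) (j + 1) (SU N)).restrict (domAltOfRecord F N ν K (j + 1))).prod (τ j)).withDensity (fun p => (J j p : ℝ≥0∞))).map (Φ j))
    (hmeas : ∀ j < K, ∀ V₀ ∈ domAltOfRecord F N ν K (j + 1), ∀ᶠ V in 𝓝[domAltOfRecord F N ν K (j + 1)] V₀,
      AEStronglyMeasurable (fun z => (J j (V, z) : ℝ) * betaInputOfRecord F N (TcanOfRecord F N) (chiFixed29 F N ν ε₁) K g j (Φ j (V, z))) (τ j))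
    (hconf : ∀ j < K, ∀ V₀ ∈ domAltOfRecord F N ν K (j + 1), ∃ C ⊆ domAltOfRecord F N ν K j, IsCompact C ∧ ∃ bound : Z j → ℝ, Integrable bound (τ j) ∧
      ∀ᶠ V in 𝓝[domAltOfRecord F N ν K (j + 1)] V₀, ∀ᵐ z ∂(τ j), (J j (V, z) : ℝ) ≤ bound z ∧ Φ j (V, z) ∈ C)
    (hΦV : ∀ j < K, ∀ V₀ ∈ domAltOfRecord F N ν K (j + 1), ∀ᵐ z ∂(τ j), ContinuousWithinAt (fun V => Φ j (V, z)) (domAltOfRecord F N ν K (j + 1)) V₀)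
    (hJV : ∀ j < K, ∀ V₀ ∈ domAltOfRecord F N ν K (j + 1), ∀ᵐ z ∂(τ j), ContinuousWithinAt (fun V => (J j (V, z) : ℝ)) (domAltOfRecord F N ν K (j + 1)) V₀)
    (hφ : ∀ j < K, ∀ V₀ ∈ domAltOfRecord F N ν K (j + 1), ∀ b : PBond (F.P K) j, ¬ IsB0 b →
      ∀ᵐ z ∂(τ j), ContinuousWithinAt (fun V => fluctDevOfRecord F N ν K j (Φ j (V, z)) b) (domAltOfRecord F N ν K (j + 1)) V₀)
    (hnull : ∀ j < K, ∀ V₀ ∈ domAltOfRecord F N ν K (j + 1), ∀ b : PBond (F.P K) j, ¬ IsB0 b →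
      τ j {z | fluctDevOfRecord F N ν K j (Φ j (V₀, z)) b = ε₁} = 0)
    (hz₀ : ∀ j < K, ∀ V ∈ domAltOfRecord F N ν K (j + 1), Φ j (V, z₀ j V) = critCfgOfRecord F N ν K j V)
    (hΦc : ∀ j < K, ∀ V ∈ domAltOfRecord F N ν K (j + 1), ContinuousAt (fun z => Φ j (V, z)) (z₀ j V))
    (hJpos : ∀ j < K, ∀ V ∈ domAltOfRecord F N ν K (j + 1), ∀ᶠ z in 𝓝 (z₀ j V), 0 < J j (V, z)) :
    ∀ j, j ≤ K → ContinuousOn (effActionHT F N (TcanOfRecord F N) (chiFixed29 F N ν ε₁) K g j) (domAltOfRecord F N ν K j)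
  | 0, _ => continuousOn_effActionHT_zero _ _ K g _
  | j + 1, hj => by
    have hjK : j < K := Nat.lt_of_succ_le hj
    have ih := continuousOn_effActionHT_all_of_chartRegularity hε hsolν hint hGF hΦ hJ havgΦ hmap hmeas hconf hΦV hJV hφ hnull hz₀ hΦc hJpos j hjK.le
    exact continuousOn_effActionHT_succ_of_chartRegularity ν hε K g hjK (hsolν j hjK) (hint j hjK) (hGF j hjK) ih (τ j)
      {U | chiFixed29 F N ν ε₁ K g j U ≠ 0} (fun U hU => mem_setOf_chi_ne_zero_of_betaInputOfRecord_ne_zero _ _ _ _ _ U hU) (Φ j) (J j) (hΦ j) (hJ j)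
      (havgΦ j hjK) (hmap j hjK) (hmeas j hjK) (hconf j hjK) (hΦV j hjK) (hJV j hjK) (hφ j hjK) (hnull j hjK) (z₀ j) (hz₀ j hjK) (hΦc j hjK) (hJpos j hjK)

/-- **★★★ … HENCE `hreg_j` AND (F3)_j FOR EVERY `j < K`**: `domAlt_{j+1} ⊆ regSetOfRecord K j ρ_j` and `0 < TcanOfRecord K j ρ_j V` at every `V ∈ domAlt_{j+1}` (FILE 2's
`hreg_pos_contA_of_chartRegularity` at step `j`, fed with the tower's `A_j`). [cite: Balaban1987RG1, p.259, (0.19) p.255 and (2.10) p.267] -/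
theorem hreg_pos_all_of_chartRegularity (hε : 0 < ε₁)
    (hsolν : ∀ j < K, ∀ W ∈ domAltOfRecord F N ν K (j + 1), UkExists F N K (j + 1) ν.εreg W)
    (hint : ∀ j < K, Integrable (betaInputOfRecord F N (TcanOfRecord F N) (chiFixed29 F N ν ε₁) K g j) (fieldMeasure (F.P K) j (SU N)))
    (hGF : ∀ j < K, ContinuousOn (gfOfRecord F N K j) (domAltOfRecord F N ν K j))
    (hΦ : ∀ j, Measurable (Φ j)) (hJ : ∀ j, Measurable (J j))
    (havgΦ : ∀ j < K, ∀ V ∈ domAltOfRecord F N ν K (j + 1), ∀ z, (avOfRecord F N K j).avg (Φ j (V, z)) = V)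
    (hmap : ∀ j < K, (fieldMeasure (F.P K) j (SU N)).restrict ((avOfRecord F N K j).avg ⁻¹' domAltOfRecord F N ν K (j + 1) ∩
        {U | chiFixed29 F N ν ε₁ K g j U ≠ 0})
      = ((((piHaar (F.P K) (j + 1) (SU N)).restrict (domAltOfRecord F N ν K (j + 1))).prod (τ j)).withDensity (fun p => (J j p : ℝ≥0∞))).map (Φ j))
    (hmeas : ∀ j < K, ∀ V₀ ∈ domAltOfRecord F N ν K (j + 1), ∀ᶠ V in 𝓝[domAltOfRecord F N ν K (j + 1)] V₀,
      AEStronglyMeasurable (fun z => (J j (V, z) : ℝ) * betaInputOfRecord F N (TcanOfRecord F N) (chiFixed29 F N ν ε₁) K g j (Φ j (V, z))) (τ j))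
    (hconf : ∀ j < K, ∀ V₀ ∈ domAltOfRecord F N ν K (j + 1), ∃ C ⊆ domAltOfRecord F N ν K j, IsCompact C ∧ ∃ bound : Z j → ℝ, Integrable bound (τ j) ∧
      ∀ᶠ V in 𝓝[domAltOfRecord F N ν K (j + 1)] V₀, ∀ᵐ z ∂(τ j), (J j (V, z) : ℝ) ≤ bound z ∧ Φ j (V, z) ∈ C)
    (hΦV : ∀ j < K, ∀ V₀ ∈ domAltOfRecord F N ν K (j + 1), ∀ᵐ z ∂(τ j), ContinuousWithinAt (fun V => Φ j (V, z)) (domAltOfRecord F N ν K (j + 1)) V₀)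
    (hJV : ∀ j < K, ∀ V₀ ∈ domAltOfRecord F N ν K (j + 1), ∀ᵐ z ∂(τ j), ContinuousWithinAt (fun V => (J j (V, z) : ℝ)) (domAltOfRecord F N ν K (j + 1)) V₀)
    (hφ : ∀ j < K, ∀ V₀ ∈ domAltOfRecord F N ν K (j + 1), ∀ b : PBond (F.P K) j, ¬ IsB0 b →
      ∀ᵐ z ∂(τ j), ContinuousWithinAt (fun V => fluctDevOfRecord F N ν K j (Φ j (V, z)) b) (domAltOfRecord F N ν K (j + 1)) V₀)
    (hnull : ∀ j < K, ∀ V₀ ∈ domAltOfRecord F N ν K (j + 1), ∀ b : PBond (F.P K) j, ¬ IsB0 b →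
      τ j {z | fluctDevOfRecord F N ν K j (Φ j (V₀, z)) b = ε₁} = 0)
    (hz₀ : ∀ j < K, ∀ V ∈ domAltOfRecord F N ν K (j + 1), Φ j (V, z₀ j V) = critCfgOfRecord F N ν K j V)
    (hΦc : ∀ j < K, ∀ V ∈ domAltOfRecord F N ν K (j + 1), ContinuousAt (fun z => Φ j (V, z)) (z₀ j V))
    (hJpos : ∀ j < K, ∀ V ∈ domAltOfRecord F N ν K (j + 1), ∀ᶠ z in 𝓝 (z₀ j V), 0 < J j (V, z)) :
    ∀ j < K, domAltOfRecord F N ν K (j + 1) ⊆ regSetOfRecord F N K j (betaInputOfRecord F N (TcanOfRecord F N) (chiFixed29 F N ν ε₁) K g j) ∧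
      ∀ V ∈ domAltOfRecord F N ν K (j + 1), 0 < TcanOfRecord F N K j (betaInputOfRecord F N (TcanOfRecord F N) (chiFixed29 F N ν ε₁) K g j) V := by
  intro j hjK
  have ih := continuousOn_effActionHT_all_of_chartRegularity ν K g τ Φ J z₀ hε hsolν hint hGF hΦ hJ havgΦ hmap hmeas hconf hΦV hJV hφ hnull hz₀ hΦc hJpos
    j hjK.le
  have h := hreg_pos_contA_of_chartRegularity ν hε K g hjK (hsolν j hjK) (hint j hjK) (hGF j hjK) ih (τ j)
    {U | chiFixed29 F N ν ε₁ K g j U ≠ 0} (fun U hU => mem_setOf_chi_ne_zero_of_betaInputOfRecord_ne_zero _ _ _ _ _ U hU) (Φ j) (J j) (hΦ j) (hJ j)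
    (havgΦ j hjK) (hmap j hjK) (hmeas j hjK) (hconf j hjK) (hΦV j hjK) (hJV j hjK) (hφ j hjK) (hnull j hjK) (z₀ j) (hz₀ j hjK) (hΦc j hjK) (hJpos j hjK)
  exact ⟨h.1, h.2.1⟩

end Tower

/-! ## §2 At the Stage-13 record, run by run: `hreg` as a theorem of A-free chart regularity; dag-n09-w4 g3's door with `hreg` gone -/

section Record

variable (θ : Stage13Params F N) (P : B12.RunParams)
  {Z : ℕ → Type*} [∀ j, TopologicalSpace (Z j)] [∀ j, MeasurableSpace (Z j)] (τ : ∀ j, Measure (Z j)) [∀ j, SFinite (τ j)] [∀ j, (τ j).IsOpenPosMeasure]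
  (Φ : ∀ j, (PBond (F.P P.K) (j + 1) → SU N) × Z j → GaugeField (F.P P.K) j (SU N))
  (J : ∀ j, (PBond (F.P P.K) (j + 1) → SU N) × Z j → ℝ≥0)
  (z₀ : ∀ j, (PBond (F.P P.K) (j + 1) → SU N) → Z j)

/-- **★★ THE DOORS' ANALYTIC INCLUSION `hreg` AT THE STAGE-13 RECORD FROM A-FREE PER-STEP CHART REGULARITY** (run `P`; `TβOfRecord₁₃ = TcanOfRecord`, `chiβOfRecord₁₃ θ =
chiFixed29 θ.ν θ.ε₂₉`; charted sets pinned to `{χ^{(2.9)}_j ≠ 0}`): `∀ j < P.K, domAltOfRecord θ.ν P.K (j+1) ⊆ regSetOfRecord P.K j ρ_j` — the binder of dag-n09-w3 g2's ∕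
dag-n09-w4 g3's doors VERBATIM, now WITHOUT `hgc` and WITHOUT any `A_j` in the chart data (§1's tower). [cite: Balaban1987RG1, p.259, (2.10) p.267 and (0.13) p.254] -/
theorem hreg_of_chartRegularity (hε : 0 < θ.ε₂₉)
    (hsolν : ∀ j < P.K, ∀ W ∈ domAltOfRecord F N θ.ν P.K (j + 1), UkExists F N P.K (j + 1) θ.ν.εreg W)
    (hint : ∀ j < P.K, Integrable (betaInputOfRecord F N (TβOfRecord₁₃ F N) (chiβOfRecord₁₃ F N θ) P.K (gOfRecord₁₃ F N θ P) j) (fieldMeasure (F.P P.K) j (SU N)))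
    (hGF : ∀ j < P.K, ContinuousOn (gfOfRecord F N P.K j) (domAltOfRecord F N θ.ν P.K j))
    (hΦ : ∀ j, Measurable (Φ j)) (hJ : ∀ j, Measurable (J j))
    (havgΦ : ∀ j < P.K, ∀ V ∈ domAltOfRecord F N θ.ν P.K (j + 1), ∀ z, (avOfRecord F N P.K j).avg (Φ j (V, z)) = V)
    (hmap : ∀ j < P.K, (fieldMeasure (F.P P.K) j (SU N)).restrict ((avOfRecord F N P.K j).avg ⁻¹' domAltOfRecord F N θ.ν P.K (j + 1) ∩
        {U | chiβOfRecord₁₃ F N θ P.K (gOfRecord₁₃ F N θ P) j U ≠ 0})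
      = ((((piHaar (F.P P.K) (j + 1) (SU N)).restrict (domAltOfRecord F N θ.ν P.K (j + 1))).prod (τ j)).withDensity
          (fun p => (J j p : ℝ≥0∞))).map (Φ j))
    (hmeas : ∀ j < P.K, ∀ V₀ ∈ domAltOfRecord F N θ.ν P.K (j + 1), ∀ᶠ V in 𝓝[domAltOfRecord F N θ.ν P.K (j + 1)] V₀,
      AEStronglyMeasurable (fun z => (J j (V, z) : ℝ) *
        betaInputOfRecord F N (TβOfRecord₁₃ F N) (chiβOfRecord₁₃ F N θ) P.K (gOfRecord₁₃ F N θ P) j (Φ j (V, z))) (τ j))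
    (hconf : ∀ j < P.K, ∀ V₀ ∈ domAltOfRecord F N θ.ν P.K (j + 1), ∃ C ⊆ domAltOfRecord F N θ.ν P.K j, IsCompact C ∧ ∃ bound : Z j → ℝ, Integrable bound (τ j) ∧
      ∀ᶠ V in 𝓝[domAltOfRecord F N θ.ν P.K (j + 1)] V₀, ∀ᵐ z ∂(τ j), (J j (V, z) : ℝ) ≤ bound z ∧ Φ j (V, z) ∈ C)
    (hΦV : ∀ j < P.K, ∀ V₀ ∈ domAltOfRecord F N θ.ν P.K (j + 1), ∀ᵐ z ∂(τ j),
      ContinuousWithinAt (fun V => Φ j (V, z)) (domAltOfRecord F N θ.ν P.K (j + 1)) V₀)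
    (hJV : ∀ j < P.K, ∀ V₀ ∈ domAltOfRecord F N θ.ν P.K (j + 1), ∀ᵐ z ∂(τ j),
      ContinuousWithinAt (fun V => (J j (V, z) : ℝ)) (domAltOfRecord F N θ.ν P.K (j + 1)) V₀)
    (hφ : ∀ j < P.K, ∀ V₀ ∈ domAltOfRecord F N θ.ν P.K (j + 1), ∀ b : PBond (F.P P.K) j, ¬ IsB0 b → ∀ᵐ z ∂(τ j),
      ContinuousWithinAt (fun V => fluctDevOfRecord F N θ.ν P.K j (Φ j (V, z)) b) (domAltOfRecord F N θ.ν P.K (j + 1)) V₀)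
    (hnull : ∀ j < P.K, ∀ V₀ ∈ domAltOfRecord F N θ.ν P.K (j + 1), ∀ b : PBond (F.P P.K) j, ¬ IsB0 b →
      τ j {z | fluctDevOfRecord F N θ.ν P.K j (Φ j (V₀, z)) b = θ.ε₂₉} = 0)
    (hz₀ : ∀ j < P.K, ∀ V ∈ domAltOfRecord F N θ.ν P.K (j + 1), Φ j (V, z₀ j V) = critCfgOfRecord F N θ.ν P.K j V)
    (hΦc : ∀ j < P.K, ∀ V ∈ domAltOfRecord F N θ.ν P.K (j + 1), ContinuousAt (fun z => Φ j (V, z)) (z₀ j V))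
    (hJpos : ∀ j < P.K, ∀ V ∈ domAltOfRecord F N θ.ν P.K (j + 1), ∀ᶠ z in 𝓝 (z₀ j V), 0 < J j (V, z)) :
    ∀ j < P.K, domAltOfRecord F N θ.ν P.K (j + 1) ⊆ regSetOfRecord F N P.K j
      (betaInputOfRecord F N (TβOfRecord₁₃ F N) (chiβOfRecord₁₃ F N θ) P.K (gOfRecord₁₃ F N θ P) j) :=
  fun j hj => (hreg_pos_all_of_chartRegularity θ.ν P.K (gOfRecord₁₃ F N θ P) τ Φ J z₀ hε hsolν hint hGF hΦ hJ havgΦ hmap hmeas hconf hΦV hJV hφ hnull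
    hz₀ hΦc hJpos j hj).1

/-- **★★ (F3) ON EVERY DOMAIN AT THE STAGE-13 RECORD** from the same data: `0 < TβOfRecord₁₃ P.K j ρ_j V` at every `V ∈ domAltOfRecord θ.ν P.K (j+1)`, every `j < P.K`.
[cite: Balaban1987RG1, (0.19) p.255, p.259 and (2.10) p.267] -/
theorem pos_of_chartRegularity (hε : 0 < θ.ε₂₉)
    (hsolν : ∀ j < P.K, ∀ W ∈ domAltOfRecord F N θ.ν P.K (j + 1), UkExists F N P.K (j + 1) θ.ν.εreg W)
    (hint : ∀ j < P.K, Integrable (betaInputOfRecord F N (TβOfRecord₁₃ F N) (chiβOfRecord₁₃ F N θ) P.K (gOfRecord₁₃ F N θ P) j) (fieldMeasure (F.P P.K) j (SU N)))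
    (hGF : ∀ j < P.K, ContinuousOn (gfOfRecord F N P.K j) (domAltOfRecord F N θ.ν P.K j))
    (hΦ : ∀ j, Measurable (Φ j)) (hJ : ∀ j, Measurable (J j))
    (havgΦ : ∀ j < P.K, ∀ V ∈ domAltOfRecord F N θ.ν P.K (j + 1), ∀ z, (avOfRecord F N P.K j).avg (Φ j (V, z)) = V)
    (hmap : ∀ j < P.K, (fieldMeasure (F.P P.K) j (SU N)).restrict ((avOfRecord F N P.K j).avg ⁻¹' domAltOfRecord F N θ.ν P.K (j + 1) ∩
        {U | chiβOfRecord₁₃ F N θ P.K (gOfRecord₁₃ F N θ P) j U ≠ 0})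
      = ((((piHaar (F.P P.K) (j + 1) (SU N)).restrict (domAltOfRecord F N θ.ν P.K (j + 1))).prod (τ j)).withDensity
          (fun p => (J j p : ℝ≥0∞))).map (Φ j))
    (hmeas : ∀ j < P.K, ∀ V₀ ∈ domAltOfRecord F N θ.ν P.K (j + 1), ∀ᶠ V in 𝓝[domAltOfRecord F N θ.ν P.K (j + 1)] V₀,
      AEStronglyMeasurable (fun z => (J j (V, z) : ℝ) *
        betaInputOfRecord F N (TβOfRecord₁₃ F N) (chiβOfRecord₁₃ F N θ) P.K (gOfRecord₁₃ F N θ P) j (Φ j (V, z))) (τ j))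
    (hconf : ∀ j < P.K, ∀ V₀ ∈ domAltOfRecord F N θ.ν P.K (j + 1), ∃ C ⊆ domAltOfRecord F N θ.ν P.K j, IsCompact C ∧ ∃ bound : Z j → ℝ, Integrable bound (τ j) ∧
      ∀ᶠ V in 𝓝[domAltOfRecord F N θ.ν P.K (j + 1)] V₀, ∀ᵐ z ∂(τ j), (J j (V, z) : ℝ) ≤ bound z ∧ Φ j (V, z) ∈ C)
    (hΦV : ∀ j < P.K, ∀ V₀ ∈ domAltOfRecord F N θ.ν P.K (j + 1), ∀ᵐ z ∂(τ j),
      ContinuousWithinAt (fun V => Φ j (V, z)) (domAltOfRecord F N θ.ν P.K (j + 1)) V₀)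
    (hJV : ∀ j < P.K, ∀ V₀ ∈ domAltOfRecord F N θ.ν P.K (j + 1), ∀ᵐ z ∂(τ j),
      ContinuousWithinAt (fun V => (J j (V, z) : ℝ)) (domAltOfRecord F N θ.ν P.K (j + 1)) V₀)
    (hφ : ∀ j < P.K, ∀ V₀ ∈ domAltOfRecord F N θ.ν P.K (j + 1), ∀ b : PBond (F.P P.K) j, ¬ IsB0 b → ∀ᵐ z ∂(τ j),
      ContinuousWithinAt (fun V => fluctDevOfRecord F N θ.ν P.K j (Φ j (V, z)) b) (domAltOfRecord F N θ.ν P.K (j + 1)) V₀)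
    (hnull : ∀ j < P.K, ∀ V₀ ∈ domAltOfRecord F N θ.ν P.K (j + 1), ∀ b : PBond (F.P P.K) j, ¬ IsB0 b →
      τ j {z | fluctDevOfRecord F N θ.ν P.K j (Φ j (V₀, z)) b = θ.ε₂₉} = 0)
    (hz₀ : ∀ j < P.K, ∀ V ∈ domAltOfRecord F N θ.ν P.K (j + 1), Φ j (V, z₀ j V) = critCfgOfRecord F N θ.ν P.K j V)
    (hΦc : ∀ j < P.K, ∀ V ∈ domAltOfRecord F N θ.ν P.K (j + 1), ContinuousAt (fun z => Φ j (V, z)) (z₀ j V))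
    (hJpos : ∀ j < P.K, ∀ V ∈ domAltOfRecord F N θ.ν P.K (j + 1), ∀ᶠ z in 𝓝 (z₀ j V), 0 < J j (V, z)) :
    ∀ j < P.K, ∀ V ∈ domAltOfRecord F N θ.ν P.K (j + 1),
      0 < TβOfRecord₁₃ F N P.K j (betaInputOfRecord F N (TβOfRecord₁₃ F N) (chiβOfRecord₁₃ F N θ) P.K (gOfRecord₁₃ F N θ P) j) V :=
  fun j hj => (hreg_pos_all_of_chartRegularity θ.ν P.K (gOfRecord₁₃ F N θ P) τ Φ J z₀ hε hsolν hint hGF hΦ hJ havgΦ hmap hmeas hconf hΦV hJV hφ hnull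
    hz₀ hΦc hJpos j hj).2

/-- **★★ EVERY NORMALISATION CONSTANT `𝐍_j = T_jρ_j(1)` IS POSITIVE and (0.19) HOLDS ON EVERY DOMAIN**: for `j < P.K`, `0 < normConstHT (TβOfRecord₁₃) (chiβOfRecord₁₃ θ) P.K g j`
(`1 ∈ domAlt_{j+1}` when `0 < ν.ε₀`, K0e's `one_mem_domAltOfRecord`) and `T_jρ_j(V) = 𝐍_j·exp(A_{j+1}(V))` at every `V ∈ domAltOfRecord θ.ν P.K (j+1)` (lit-balaban r20's
`normConst_mul_exp_nextAction`, both positivity hypotheses supplied by `pos_of_chartRegularity`). [cite: Balaban1987RG1, (0.19) p.255–256 and p.259] -/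
theorem normConst_pos_and_eq_exp_of_chartRegularity (hε₀ : 0 < θ.ν.ε₀) (hε : 0 < θ.ε₂₉)
    (hsolν : ∀ j < P.K, ∀ W ∈ domAltOfRecord F N θ.ν P.K (j + 1), UkExists F N P.K (j + 1) θ.ν.εreg W)
    (hint : ∀ j < P.K, Integrable (betaInputOfRecord F N (TβOfRecord₁₃ F N) (chiβOfRecord₁₃ F N θ) P.K (gOfRecord₁₃ F N θ P) j) (fieldMeasure (F.P P.K) j (SU N)))
    (hGF : ∀ j < P.K, ContinuousOn (gfOfRecord F N P.K j) (domAltOfRecord F N θ.ν P.K j))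
    (hΦ : ∀ j, Measurable (Φ j)) (hJ : ∀ j, Measurable (J j))
    (havgΦ : ∀ j < P.K, ∀ V ∈ domAltOfRecord F N θ.ν P.K (j + 1), ∀ z, (avOfRecord F N P.K j).avg (Φ j (V, z)) = V)
    (hmap : ∀ j < P.K, (fieldMeasure (F.P P.K) j (SU N)).restrict ((avOfRecord F N P.K j).avg ⁻¹' domAltOfRecord F N θ.ν P.K (j + 1) ∩
        {U | chiβOfRecord₁₃ F N θ P.K (gOfRecord₁₃ F N θ P) j U ≠ 0})
      = ((((piHaar (F.P P.K) (j + 1) (SU N)).restrict (domAltOfRecord F N θ.ν P.K (j + 1))).prod (τ j)).withDensity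
          (fun p => (J j p : ℝ≥0∞))).map (Φ j))
    (hmeas : ∀ j < P.K, ∀ V₀ ∈ domAltOfRecord F N θ.ν P.K (j + 1), ∀ᶠ V in 𝓝[domAltOfRecord F N θ.ν P.K (j + 1)] V₀,
      AEStronglyMeasurable (fun z => (J j (V, z) : ℝ) *
        betaInputOfRecord F N (TβOfRecord₁₃ F N) (chiβOfRecord₁₃ F N θ) P.K (gOfRecord₁₃ F N θ P) j (Φ j (V, z))) (τ j))
    (hconf : ∀ j < P.K, ∀ V₀ ∈ domAltOfRecord F N θ.ν P.K (j + 1), ∃ C ⊆ domAltOfRecord F N θ.ν P.K j, IsCompact C ∧ ∃ bound : Z j → ℝ, Integrable bound (τ j) ∧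
      ∀ᶠ V in 𝓝[domAltOfRecord F N θ.ν P.K (j + 1)] V₀, ∀ᵐ z ∂(τ j), (J j (V, z) : ℝ) ≤ bound z ∧ Φ j (V, z) ∈ C)
    (hΦV : ∀ j < P.K, ∀ V₀ ∈ domAltOfRecord F N θ.ν P.K (j + 1), ∀ᵐ z ∂(τ j),
      ContinuousWithinAt (fun V => Φ j (V, z)) (domAltOfRecord F N θ.ν P.K (j + 1)) V₀)
    (hJV : ∀ j < P.K, ∀ V₀ ∈ domAltOfRecord F N θ.ν P.K (j + 1), ∀ᵐ z ∂(τ j),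
      ContinuousWithinAt (fun V => (J j (V, z) : ℝ)) (domAltOfRecord F N θ.ν P.K (j + 1)) V₀)
    (hφ : ∀ j < P.K, ∀ V₀ ∈ domAltOfRecord F N θ.ν P.K (j + 1), ∀ b : PBond (F.P P.K) j, ¬ IsB0 b → ∀ᵐ z ∂(τ j),
      ContinuousWithinAt (fun V => fluctDevOfRecord F N θ.ν P.K j (Φ j (V, z)) b) (domAltOfRecord F N θ.ν P.K (j + 1)) V₀)
    (hnull : ∀ j < P.K, ∀ V₀ ∈ domAltOfRecord F N θ.ν P.K (j + 1), ∀ b : PBond (F.P P.K) j, ¬ IsB0 b →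
      τ j {z | fluctDevOfRecord F N θ.ν P.K j (Φ j (V₀, z)) b = θ.ε₂₉} = 0)
    (hz₀ : ∀ j < P.K, ∀ V ∈ domAltOfRecord F N θ.ν P.K (j + 1), Φ j (V, z₀ j V) = critCfgOfRecord F N θ.ν P.K j V)
    (hΦc : ∀ j < P.K, ∀ V ∈ domAltOfRecord F N θ.ν P.K (j + 1), ContinuousAt (fun z => Φ j (V, z)) (z₀ j V))
    (hJpos : ∀ j < P.K, ∀ V ∈ domAltOfRecord F N θ.ν P.K (j + 1), ∀ᶠ z in 𝓝 (z₀ j V), 0 < J j (V, z)) :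
    ∀ j < P.K, 0 < normConstHT F N (TβOfRecord₁₃ F N) (chiβOfRecord₁₃ F N θ) P.K (gOfRecord₁₃ F N θ P) j ∧
      ∀ V ∈ domAltOfRecord F N θ.ν P.K (j + 1),
        TβOfRecord₁₃ F N P.K j (betaInputOfRecord F N (TβOfRecord₁₃ F N) (chiβOfRecord₁₃ F N θ) P.K (gOfRecord₁₃ F N θ P) j) V
          = normConstHT F N (TβOfRecord₁₃ F N) (chiβOfRecord₁₃ F N θ) P.K (gOfRecord₁₃ F N θ P) j *
            Real.exp (effActionHT F N (TβOfRecord₁₃ F N) (chiβOfRecord₁₃ F N θ) P.K (gOfRecord₁₃ F N θ P) (j + 1) V) := by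
  intro j hj
  have hpos := pos_of_chartRegularity θ P τ Φ J z₀ hε hsolν hint hGF hΦ hJ havgΦ hmap hmeas hconf hΦV hJV hφ hnull hz₀ hΦc hJpos j hj
  have hN : 0 < normConstHT F N (TβOfRecord₁₃ F N) (chiβOfRecord₁₃ F N θ) P.K (gOfRecord₁₃ F N θ P) j :=
    hpos 1 (one_mem_domAltOfRecord θ.ν hε₀ P.K (j + 1))
  refine ⟨hN, fun V hV => ?_⟩
  rw [effActionHT_succ]
  exact (normConst_mul_exp_nextAction _ _ _ _ _ hN (hpos V hV)).symm

end Record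

/-! ## §3 dag-n09-w4 g3's small-field-bookkeeping door with `hreg` REPLACED by A-free per-step chart regularity -/

section Door

variable (θ : Stage13HParams F N) (h : θ.Provisos₁₃SepCoPH F N) {w : WorldP} (P : B12.RunParams)
  {Z : ℕ → Type*} [∀ j, TopologicalSpace (Z j)] [∀ j, MeasurableSpace (Z j)] (τ : ∀ j, Measure (Z j)) [∀ j, SFinite (τ j)] [∀ j, (τ j).IsOpenPosMeasure]
  (Φ : ∀ j, (PBond (F.P P.K) (j + 1) → SU N) × Z j → GaugeField (F.P P.K) j (SU N))
  (J : ∀ j, (PBond (F.P P.K) (j + 1) → SU N) × Z j → ℝ≥0)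
  (z₀ : ∀ j, (PBond (F.P P.K) (j + 1) → SU N) → Z j)

/-- **★★★ N09's THEOREM-3 MEMBER AT THE STAGE-13 RECORD WITH THE ANALYTIC INCLUSION `hreg` REPLACED BY A-FREE PER-STEP CHART REGULARITY**
(dag-n09-w4 g3's `…N09B0RiderAtRecord.thm3Member_stage13SepCoPH_atDomAlt_of_numerics_of_εreg_eq` with `hreg := hreg_of_chartRegularity …`): N09-side inputs = (181)ˢᵒˡ `hcov`,
`hsolν` + [B11] ×3 at one radius (N07), (I19) `hint`, NUMERICS on the record's letters, and — in place of `hreg` — per step `j < P.K` a fibred chart of the averaging of record over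
`domAlt_{j+1}` on `{χ^{(2.9)}_j ≠ 0}` through the critical configuration with A-FREE regularity (`hΦ hJ havgΦ hmap hmeas hconf hΦV hJV hφ hnull hz₀ hΦc hJpos`) and `GF_j` continuous on
`domAlt_j`.  CONDITIONAL; nothing of Bałaban's asserted; N09 NOT discharged. [cite: Balaban1987RG1, Thm 3 p.264, p.259, (0.17)–(0.19) p.255, (2.9) p.266, (2.10) p.267; Balaban1985Variational, Thm 1 (8)–(10) p.279 and (181) p.307] -/
theorem thm3Member_stage13SepCoPH_atDomAlt_of_chartRegularity_of_numerics_of_εreg_eq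
    (hC : w.C = (datumOfRecord₁₃SepCoPH F N θ h).C) (hε : 0 < θ.ε₂₉) (heq : θ.toStage13Params.ν.εreg = θ.εbg)
    (hεreg : 0 < θ.toStage13Params.ν.εreg)
    (hε3 : (143 * (((((F.P P.K).d + 4 : ℕ) : ℝ)) ^ 2 / 4) ^ 2) * θ.toStage13Params.ν.εreg ≤ 1 / 3)
    (hε2 : 2 * θ.toStage13Params.ν.εreg ≤ 2 * deltaSU (Fin N) / ((((F.P P.K).d + 4) * (F.P P.K).L : ℕ) : ℝ) ^ 2)
    (hord : 2 * θ.toStage13Params.ν.εreg / ((F.P P.K).L : ℝ) ^ 2 +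
      4 * max θ.toStage13Params.ε₂₉ (10 * (((((F.P P.K).d + 2) * (F.P P.K).L : ℕ) : ℝ) * θ.toStage13Params.ε₂₉) * ((F.P P.K).L : ℝ) ^ ((F.P P.K).d - 1)) ≤
        θ.toStage13Params.ν.ε₀)
    (hn1 : 1640 * (2 * (((((F.P P.K).d + 2) * (F.P P.K).L : ℕ) : ℝ) * θ.toStage13Params.ε₂₉) +
        ((((F.P P.K).d + 2) * (F.P P.K).L : ℕ) : ℝ) ^ 2 / 4 * (2 * θ.toStage13Params.ν.εreg / ((F.P P.K).L : ℝ) ^ 2)) *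
          (((F.P P.K).L : ℝ) ^ ((F.P P.K).d - 1)) ^ 2 ≤ 1)
    (hn2 : 13 * (2 * (((((F.P P.K).d + 2) * (F.P P.K).L : ℕ) : ℝ) * θ.toStage13Params.ε₂₉) +
        ((((F.P P.K).d + 2) * (F.P P.K).L : ℕ) : ℝ) ^ 2 / 4 * (2 * θ.toStage13Params.ν.εreg / ((F.P P.K).L : ℝ) ^ 2)) *
          ((F.P P.K).L : ℝ) ^ ((F.P P.K).d - 1) < deltaSU (Fin N))
    (hcov : ∀ j < P.K, ∀ (v : GaugeTransf (F.P P.K) (j + 1) (SU N)) (W : GaugeField (F.P P.K) (j + 1) (SU N)),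
      UkExists F N P.K (j + 1) θ.toStage13Params.ν.εreg W →
        critCfgOfRecord F N θ.toStage13Params.ν P.K j (gaugeAct v W) = gaugeAct (liftTransf v) (critCfgOfRecord F N θ.toStage13Params.ν P.K j W))
    (hsolν : ∀ j < P.K, ∀ W ∈ domAltOfRecord F N θ.ν P.K (j + 1), UkExists F N P.K (j + 1) θ.toStage13Params.ν.εreg W)
    (hint : ∀ j < P.K, Integrable (betaInputOfRecord F N (TβOfRecord₁₃ F N) (chiβOfRecord₁₃ F N θ.toStage13Params) P.K (gOfRecord₁₃ F N θ.toStage13Params P) j)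
      (fieldMeasure (F.P P.K) j (SU N)))
    (hGF : ∀ j < P.K, ContinuousOn (gfOfRecord F N P.K j) (domAltOfRecord F N θ.ν P.K j))
    (hΦ : ∀ j, Measurable (Φ j)) (hJ : ∀ j, Measurable (J j))
    (havgΦ : ∀ j < P.K, ∀ V ∈ domAltOfRecord F N θ.ν P.K (j + 1), ∀ z, (avOfRecord F N P.K j).avg (Φ j (V, z)) = V)
    (hmap : ∀ j < P.K, (fieldMeasure (F.P P.K) j (SU N)).restrict ((avOfRecord F N P.K j).avg ⁻¹' domAltOfRecord F N θ.ν P.K (j + 1) ∩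
        {U | chiβOfRecord₁₃ F N θ.toStage13Params P.K (gOfRecord₁₃ F N θ.toStage13Params P) j U ≠ 0})
      = ((((piHaar (F.P P.K) (j + 1) (SU N)).restrict (domAltOfRecord F N θ.ν P.K (j + 1))).prod (τ j)).withDensity
          (fun p => (J j p : ℝ≥0∞))).map (Φ j))
    (hmeas : ∀ j < P.K, ∀ V₀ ∈ domAltOfRecord F N θ.ν P.K (j + 1), ∀ᶠ V in 𝓝[domAltOfRecord F N θ.ν P.K (j + 1)] V₀,
      AEStronglyMeasurable (fun z => (J j (V, z) : ℝ) *
        betaInputOfRecord F N (TβOfRecord₁₃ F N) (chiβOfRecord₁₃ F N θ.toStage13Params) P.K (gOfRecord₁₃ F N θ.toStage13Params P) j (Φ j (V, z))) (τ j))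
    (hconf : ∀ j < P.K, ∀ V₀ ∈ domAltOfRecord F N θ.ν P.K (j + 1), ∃ C ⊆ domAltOfRecord F N θ.ν P.K j, IsCompact C ∧ ∃ bound : Z j → ℝ, Integrable bound (τ j) ∧
      ∀ᶠ V in 𝓝[domAltOfRecord F N θ.ν P.K (j + 1)] V₀, ∀ᵐ z ∂(τ j), (J j (V, z) : ℝ) ≤ bound z ∧ Φ j (V, z) ∈ C)
    (hΦV : ∀ j < P.K, ∀ V₀ ∈ domAltOfRecord F N θ.ν P.K (j + 1), ∀ᵐ z ∂(τ j),
      ContinuousWithinAt (fun V => Φ j (V, z)) (domAltOfRecord F N θ.ν P.K (j + 1)) V₀)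
    (hJV : ∀ j < P.K, ∀ V₀ ∈ domAltOfRecord F N θ.ν P.K (j + 1), ∀ᵐ z ∂(τ j),
      ContinuousWithinAt (fun V => (J j (V, z) : ℝ)) (domAltOfRecord F N θ.ν P.K (j + 1)) V₀)
    (hφ : ∀ j < P.K, ∀ V₀ ∈ domAltOfRecord F N θ.ν P.K (j + 1), ∀ b : PBond (F.P P.K) j, ¬ IsB0 b → ∀ᵐ z ∂(τ j),
      ContinuousWithinAt (fun V => fluctDevOfRecord F N θ.toStage13Params.ν P.K j (Φ j (V, z)) b) (domAltOfRecord F N θ.ν P.K (j + 1)) V₀)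
    (hnull : ∀ j < P.K, ∀ V₀ ∈ domAltOfRecord F N θ.ν P.K (j + 1), ∀ b : PBond (F.P P.K) j, ¬ IsB0 b →
      τ j {z | fluctDevOfRecord F N θ.toStage13Params.ν P.K j (Φ j (V₀, z)) b = θ.toStage13Params.ε₂₉} = 0)
    (hz₀ : ∀ j < P.K, ∀ V ∈ domAltOfRecord F N θ.ν P.K (j + 1), Φ j (V, z₀ j V) = critCfgOfRecord F N θ.toStage13Params.ν P.K j V)
    (hΦc : ∀ j < P.K, ∀ V ∈ domAltOfRecord F N θ.ν P.K (j + 1), ContinuousAt (fun z => Φ j (V, z)) (z₀ j V))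
    (hJpos : ∀ j < P.K, ∀ V ∈ domAltOfRecord F N θ.ν P.K (j + 1), ∀ᶠ z in 𝓝 (z₀ j V), 0 < J j (V, z))
    (h11 : ∀ k, k ≤ P.K → ∀ V ∈ domAltOfRecord F N θ.ν P.K k, UkExists F N P.K k θ.εbg V ∧ UniqueUkOrbit F N P.K k θ.εbg V)
    (hres : ∀ k, k ≤ P.K → HRestrict F N θ.εbg P.K k (domAltOfRecord F N θ.ν P.K k))
    (huniq : ∀ k, k ≤ P.K → ∀ V ∈ domAltOfRecord F N θ.ν P.K k, ∀ j < k,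
      UniqueUkOrbit F N P.K (j + 1) θ.εbg (Averaging.iter (avOfRecord F N P.K) (j + 1) (Uk F N P.K k θ.εbg V))) :
    (leavesP w P).smallCouplings → (leavesP w P).smallFieldInductive :=
  thm3Member_stage13SepCoPH_atDomAlt_of_numerics_of_εreg_eq θ h hC P hε heq hεreg hε3 hε2 hord hn1 hn2 hcov hsolν hint
    (hreg_of_chartRegularity θ.toStage13Params P τ Φ J z₀ hε hsolν hint hGF hΦ hJ havgΦ hmap hmeas hconf hΦV hJV hφ hnull hz₀ hΦc hJpos)
    h11 hres huniq

end Door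

end Summit.QuantumFields.YangMills.BalabanUVNodes.N09RegularityTowerOfChartRegularity

end
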